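import Literature.IUT.LogThetaLattice.ThetaPilotObjects
import Literature.IUT.HodgeTheaters.Conventions
import HarnessLib

/-!
# [IUTchIII] Definition 3.8 (ii): the full poly-isomorphisms of `ThetaPilotObjects.lean` ARE [IUTchI] §0's
# `PolyIso.full` in a category — dictionary (proof-only; abc-iut cell, layer L6, MERGE-MAP D12 C9-f)

S. Mochizuki, *Inter-universal Teichmüller theory III*, kurims manuscript (May 2020), Definition 3.8 (ii) p. 113
("the full poly-isomorphism of `𝓕^{⊩▶×μ}`-prime-strips `†𝔉^{⊩▶×μ}_LGP ⥲ *𝔉^{⊩▶×μ}_△`") and *Inter-universal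
Teichmüller theory I*, §0 p. 33 (a poly-isomorphism = a set of isomorphisms; the full poly-isomorphism = all of
them) [claim: Mochizuki2012, status: disputed].

abc-iut-L6-t4's `fullPolyIso (X Y : Strip) : Set (Iso X Y) := Set.univ` (`ThetaPilotObjects.lean`, p404500) is
CATEGORY-FREE: `Iso : Strip → Strip → Type` is an abstract family of isomorphism types. abc-iut-L5-t1's
`PolyIso (A B : C) := Set (A ≅ B)` / `PolyIso.full A B := Set.univ` (`HodgeTheaters/Conventions.lean`, p403728;
the cell's CANONICAL poly-isomorphism vocabulary, MERGE-MAP ruling D12) is the same notion for the objects of a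
CATEGORY. This file records the dictionary asked for under MERGE-MAP §4 C9-f: when the strips are objects of a
category and `Iso := (· ≅ ·)`, the two coincide DEFINITIONALLY (`fullPolyIso_eq_polyIsoFull`), and so do the
Θ^{×μ}_{LGP}- / Θ^{×μ}_{lgp}-links and the horizontal arrows of the LGP-Gaussian log-theta-lattice
(`thetaLGPLink_eq_polyIsoFull`, `thetaLgpLink_eq_polyIsoFull`, `horizontal_eq_polyIsoFull`). No new definitions; nothing here bears on the disputed [IUTchIII] Cor. 3.12 or takes a side.
-/

namespace Literature.IUT.LogThetaLattice

open CategoryTheory Literature.IUT.HodgeTheaters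

universe u v w

section PolyIsoDictionary

variable {Strip : Type u} [Category.{w} Strip]

/-- **C9-f**: for objects `X, Y` of a category, abc-iut-L6-t4's category-free `fullPolyIso` at
`Iso := (· ≅ ·)` IS abc-iut-L5-t1's `PolyIso.full X Y` ([IUTchI] §0 p. 33) — by `rfl`.
[claim: Mochizuki2012, status: disputed] -/
theorem fullPolyIso_eq_polyIsoFull (X Y : Strip) :
    fullPolyIso (Iso := fun A B : Strip => A ≅ B) X Y = PolyIso.full X Y :=
  rfl

variable {HT : Type u} {LogLink : HT → HT → Type v}

/-- The Θ^{×μ}_{LGP}-link of [IUTchIII] Def. 3.8 (ii) p. 113, for strips in a category, is L5-t1's full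
poly-isomorphism `PolyIso.full (†𝔉^{⊩▶×μ}_LGP) (*𝔉^{⊩▶×μ}_△)`. [claim: Mochizuki2012, status: disputed] -/
theorem thetaLGPLink_eq_polyIsoFull (D : ThetaLinkStrips LogLink Strip) {s t : HT} (lg : LogLink s t)
    (star : HT) :
    thetaLGPLink (Iso := fun A B : Strip => A ≅ B) D lg star = PolyIso.full (D.stripLGP lg) (D.stripDelta star) :=
  rfl

/-- The Θ^{×μ}_{lgp}-link of [IUTchIII] Def. 3.8 (ii) p. 113, for strips in a category, is L5-t1's
`PolyIso.full (†𝔉^{⊩▶×μ}_lgp) (*𝔉^{⊩▶×μ}_△)`. [claim: Mochizuki2012, status: disputed] -/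
theorem thetaLgpLink_eq_polyIsoFull (D : ThetaLinkStrips LogLink Strip) {s t : HT} (lg : LogLink s t)
    (star : HT) :
    thetaLgpLink (Iso := fun A B : Strip => A ≅ B) D lg star = PolyIso.full (D.stripLgp lg) (D.stripDelta star) :=
  rfl

/-- The horizontal arrow `^{n,m}𝓗𝓣 → ^{n+1,m}𝓗𝓣` of the LGP-Gaussian log-theta-lattice ([IUTchIII] Def. 3.8 (iii)
p. 114), for strips in a category, is L5-t1's full poly-isomorphism. [claim: Mochizuki2012, status: disputed] -/
theorem horizontal_eq_polyIsoFull {IsFull : ∀ {s t : HT}, LogLink s t → Prop}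
    (L : LGPGaussianLogThetaLattice LogLink IsFull) (D : ThetaLinkStrips LogLink Strip) (n m : ℤ) :
    L.horizontal (Iso := fun A B : Strip => A ≅ B) D n m =
      PolyIso.full (D.stripLGP (L.logLink n (m - 1))) (D.stripDelta (L.theater (n + 1) m)) :=
  rfl

end PolyIsoDictionary

end Literature.IUT.LogThetaLattice
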